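import Summits.QuantumAdvantage.QuantumAdvantage.Theorems.NearExactIsExact.Negative.NoCaseATwelve

/-!
# Crux `CubicForrelation.NearExactIsExact` (stmt-QuantumAdvantage-14043) — n = 12: the INVERSE PAIRING identity of the matching dual

Certificate seat `b2b-cforr-cert` (gen 33).  HONEST FRAMING: kernel-checked COMBINATORIAL identities (standard axioms) about the monomial
3-graph of a cubic polynomial in 12 variables — companions of the dual form lemma (…TwelveDigitDualForm: the cubic part of the digit class
of a type-O cubic `g = polyPhase p` is the matching dual `C* = {T : N₃(Tᶜ) odd}` of the monomial 3-graph `C` of `p`).  Nothing about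
`θ₁₂` is claimed; NOT summit progress.

Notation: `M = supp p` (monomials, supports of size `≤ 3` when `deg p ≤ 3`); for a coordinate set `K`, `N₃(K)` / `N₂(K)` = number of
`3`-sets / `2`-sets of monomials whose supports tile `K` (union `= K`; for `|K| = 9` resp. `6` the supports are then pairwise disjoint
triples).  For vertices `v ≠ w` and a monomial `s ∋ v` with `w ∉ s` put `K(s) := (insert w (supp s ∖ {v}))ᶜ` — the `9`-set obtained from
`(supp s)ᶜ` by trading `w` for `v`.
* `tdp_card_saturated_four_at v`: `N₄ = Σ_{s ∋ v} N₃((supp s)ᶜ)` for EVERY vertex `v` (the tree's `card_saturated_four` is `v = 0`): the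
  DIAGONAL of the pairing — `Σ_{jk : vjk ∈ C} C*_{vjk} ≡ N₄ ≡ 1 (mod 2)` for a type-O cubic.
* `tdp_tilings3_through v`: `N₃(K) = Σ_{s' ∋ v, supp s' ⊆ K} N₂(K ∖ supp s')` for `|K| = 9`, `v ∈ K` (tilings classified by the block
  through `v`).
* `tdp_offdiag_even`: for `v ≠ w`, `Σ_{s ∈ M : v ∈ s, w ∉ s} N₃(K(s))` is EVEN — the OFF-DIAGONAL of the pairing,
  `Σ_{jk : vjk ∈ C} C*_{wjk} ≡ 0 (mod 2)`: after `tdp_tilings3_through` the double sum runs over ordered pairs `(s, s')` of monomials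
  through `v` meeting only in `v` and avoiding `w`, with the SYMMETRIC summand `N₂([12] ∖ ({w} ∪ s ∪ s'))` and vanishing diagonal, so the
  swap involution pairs the terms off (`Finset.sum_involution` in `ZMod 2`).
Together: `Σ_{j<k} C_{vjk}·C*_{wjk} = [v = w]·N₄` — for a type-O cubic the matching dual is an "inverse" of the monomial 3-graph; in
particular `C*` has trivial radical (used in …TwelveDigitNoPeriod).

References: folklore double counting; C. Carlet (2021) §2.2 (algebraic normal form).  Axioms: the standard three.
-/

set_option linter.dupNamespace false -- D-0017: single-problem summit ⇒ `QuantumAdvantage.QuantumAdvantage` by design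

noncomputable section

namespace Summit.QuantumAdvantage.QuantumAdvantage.Theorems.CubicForrelation.NearExactIsExact

open Finset
open Literature.Computability.QuantumComplexity

section Pairing

variable (p : MvPolynomial (Fin (6 + 6)) (ZMod 2))

/-! ### The diagonal: `N₄ = Σ_{s ∋ v} N₃((supp s)ᶜ)` at every vertex -/

/-- `saturated_four_eq_biUnion` at an arbitrary vertex `v`: the `4`-sets of monomials tiling all `12` variables are the disjoint union over
the monomials `s₀ ∋ v` of `insert s₀` applied to the `3`-sets tiling `(supp s₀)ᶜ`. [folklore] -/
theorem tdp_saturated_four_eq_biUnion_at (hp : p.totalDegree ≤ 3) (v : Fin (6 + 6)) :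
    {S ∈ p.support.powerset | #S = 4 ∧ (S.biUnion fun s => s.support) = univ} =
      (p.support.filter fun s₀ => v ∈ s₀.support).biUnion fun s₀ =>
        ({S' ∈ p.support.powerset | #S' = 3 ∧ (S'.biUnion fun s => s.support) = s₀.supportᶜ}).image
          (insert s₀) := by
  ext S
  constructor
  · intro hS
    obtain ⟨hSp', hS4, hSU⟩ := mem_filter.1 hS
    have hSp : S ⊆ p.support := mem_powerset.1 hSp'
    have h0 : v ∈ S.biUnion fun s => s.support := by rw [hSU]; exact mem_univ _
    obtain ⟨s₀, hs₀S, h0s₀⟩ := mem_biUnion.1 h0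
    refine mem_biUnion.2 ⟨s₀, mem_filter.2 ⟨hSp hs₀S, h0s₀⟩, mem_image.2 ⟨S.erase s₀, ?_, insert_erase hs₀S⟩⟩
    refine mem_filter.2 ⟨mem_powerset.2 ((erase_subset _ _).trans hSp), ?_, ?_⟩
    · rw [card_erase_of_mem hs₀S, hS4]
    · symm
      apply eq_of_subset_of_card_le
      · intro i hi
        rw [mem_compl] at hi
        have hiU : i ∈ S.biUnion fun s => s.support := by rw [hSU]; exact mem_univ _
        obtain ⟨s, hsS, his⟩ := mem_biUnion.1 hiU
        have hss₀ : s ≠ s₀ := by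
          rintro rfl
          exact hi his
        exact mem_biUnion.2 ⟨s, mem_erase.2 ⟨hss₀, hsS⟩, his⟩
      · have h9 : #((S.erase s₀).biUnion fun s => s.support) ≤ 3 * #(S.erase s₀) :=
          ax_card_biUnion_le hp ((erase_subset _ _).trans hSp)
        have h3 : #s₀.support ≤ 3 := ax_card_support_le hp (hSp hs₀S)
        rw [card_erase_of_mem hs₀S, hS4] at h9
        rw [card_compl, Fintype.card_fin]
        omega
  · intro hS
    obtain ⟨s₀, hs₀F, hSim⟩ := mem_biUnion.1 hS
    obtain ⟨hs₀p, h0s₀⟩ := mem_filter.1 hs₀F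
    obtain ⟨S', hS'B, rfl⟩ := mem_image.1 hSim
    obtain ⟨hS'p', hS'3, hS'U⟩ := mem_filter.1 hS'B
    have hS'p : S' ⊆ p.support := mem_powerset.1 hS'p'
    have hs₀S' : s₀ ∉ S' := by
      intro h
      have h0 : v ∈ S'.biUnion fun s => s.support := mem_biUnion.2 ⟨s₀, h, h0s₀⟩
      rw [hS'U, mem_compl] at h0
      exact h0 h0s₀
    refine mem_filter.2 ⟨mem_powerset.2 (insert_subset hs₀p hS'p), ?_, ?_⟩
    · rw [card_insert_of_notMem hs₀S', hS'3]
    · rw [biUnion_insert, hS'U, union_compl]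

/-- **Diagonal of the pairing.**  `N₄ = Σ_{s₀ ∋ v} N₃((supp s₀)ᶜ)` for every vertex `v` (`card_saturated_four` is the case `v = 0`):
classify the perfect matchings of the monomial 3-graph by the block through `v`. [folklore] -/
theorem tdp_card_saturated_four_at (hp : p.totalDegree ≤ 3) (v : Fin (6 + 6)) :
    #{S ∈ p.support.powerset | #S = 4 ∧ (S.biUnion fun s => s.support) = univ} =
      ∑ s₀ ∈ p.support.filter (fun s₀ => v ∈ s₀.support),
        #{S' ∈ p.support.powerset | #S' = 3 ∧ (S'.biUnion fun s => s.support) = s₀.supportᶜ} := by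
  have key : ∀ s₀ ∈ p.support.filter (fun s₀ => v ∈ s₀.support),
      ∀ S' ∈ {S' ∈ p.support.powerset | #S' = 3 ∧ (S'.biUnion fun s => s.support) = s₀.supportᶜ},
        ∀ s ∈ S', v ∉ s.support := by
    intro s₀ hs₀ S' hS' s hs h0
    have h0U : v ∈ S'.biUnion fun s => s.support := mem_biUnion.2 ⟨s, hs, h0⟩
    rw [(mem_filter.1 hS').2.2, mem_compl] at h0U
    exact h0U (mem_filter.1 hs₀).2
  have hdisj : ((p.support.filter fun s₀ => v ∈ s₀.support : Finset _) : Set _).PairwiseDisjoint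
      fun s₀ => ({S' ∈ p.support.powerset | #S' = 3 ∧ (S'.biUnion fun s => s.support) = s₀.supportᶜ}).image
        (insert s₀) := by
    intro s₀ hs₀ s₁ hs₁ hne
    rw [Function.onFun, disjoint_left]
    intro S hS hS1
    obtain ⟨S', hS', rfl⟩ := mem_image.1 hS
    obtain ⟨S'', hS'', hEq⟩ := mem_image.1 hS1
    have hs₁S : s₁ ∈ insert s₀ S' := by
      rw [← hEq]
      exact mem_insert_self _ _
    rcases mem_insert.1 hs₁S with h | h
    · exact hne h.symm
    · exact key s₀ (mem_coe.1 hs₀) S' hS' s₁ h (mem_filter.1 (mem_coe.1 hs₁)).2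
  rw [tdp_saturated_four_eq_biUnion_at p hp v, card_biUnion hdisj]
  refine sum_congr rfl fun s₀ hs₀ => card_image_of_injOn fun S' hS' S'' hS'' h => ?_
  have h1 : s₀ ∉ S' := fun hm => key s₀ hs₀ S' (mem_coe.1 hS') s₀ hm (mem_filter.1 hs₀).2
  have h2 : s₀ ∉ S'' := fun hm => key s₀ hs₀ S'' (mem_coe.1 hS'') s₀ hm (mem_filter.1 hs₀).2
  rw [← erase_insert h1, h, erase_insert h2]

/-! ### Tilings of a `9`-set by three monomials, classified by the block through a vertex -/

/-- In a `3`-set of monomials tiling a `9`-set `K`, the supports of the other two monomials tile `K ∖ supp s'` for each member `s'`.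
[folklore] -/
theorem tdp_tiling3_erase (hp : p.totalDegree ≤ 3) (K : Finset (Fin (6 + 6))) (hK : #K = 9)
    (S' : Finset (Fin (6 + 6) →₀ ℕ)) (hS'p : S' ⊆ p.support) (hS'3 : #S' = 3)
    (hS'U : (S'.biUnion fun s => s.support) = K) (s' : Fin (6 + 6) →₀ ℕ) (hs' : s' ∈ S') :
    ((S'.erase s').biUnion fun s => s.support) = K \ s'.support := by
  have hsub : K \ s'.support ⊆ (S'.erase s').biUnion fun s => s.support := by
    intro i hi
    obtain ⟨hiK, his'⟩ := mem_sdiff.1 hi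
    rw [← hS'U] at hiK
    obtain ⟨s, hsS, his⟩ := mem_biUnion.1 hiK
    have hss' : s ≠ s' := by
      rintro rfl
      exact his' his
    exact mem_biUnion.2 ⟨s, mem_erase.2 ⟨hss', hsS⟩, his⟩
  have h6 : #((S'.erase s').biUnion fun s => s.support) ≤ 3 * #(S'.erase s') :=
    ax_card_biUnion_le hp ((erase_subset _ _).trans hS'p)
  rw [card_erase_of_mem hs', hS'3] at h6
  have h3 : #s'.support ≤ 3 := ax_card_support_le hp (hS'p hs')
  have hsd : #(K \ s'.support) = #K - #(K ∩ s'.support) := by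
    rw [← card_sdiff_add_card_inter K s'.support]; omega
  have hint : #(K ∩ s'.support) ≤ 3 := (card_le_card inter_subset_right).trans h3
  exact (eq_of_subset_of_card_le hsub (by rw [hsd, hK]; omega)).symm

/-- **Tilings through a vertex.**  For a `9`-set `K ∋ v`, the `3`-sets of monomials tiling `K` are the disjoint union over the monomials
`s' ∋ v` with `supp s' ⊆ K` of `insert s'` applied to the `2`-sets tiling `K ∖ supp s'`. [folklore] -/
theorem tdp_tilings3_eq_biUnion (hp : p.totalDegree ≤ 3) (v : Fin (6 + 6)) (K : Finset (Fin (6 + 6))) (hK : #K = 9)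
    (hvK : v ∈ K) :
    {S' ∈ p.support.powerset | #S' = 3 ∧ (S'.biUnion fun s => s.support) = K} =
      (p.support.filter fun s' => v ∈ s'.support ∧ s'.support ⊆ K).biUnion fun s' =>
        ({S'' ∈ p.support.powerset | #S'' = 2 ∧ (S''.biUnion fun s => s.support) = K \ s'.support}).image (insert s') := by
  ext S'
  constructor
  · intro hS'
    obtain ⟨hS'p', hS'3, hS'U⟩ := mem_filter.1 hS'
    have hS'p : S' ⊆ p.support := mem_powerset.1 hS'p'
    have hv : v ∈ S'.biUnion fun s => s.support := by rw [hS'U]; exact hvK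
    obtain ⟨s', hs'S, hvs'⟩ := mem_biUnion.1 hv
    have hsub : s'.support ⊆ K := by
      rw [← hS'U]; exact subset_biUnion_of_mem (fun s => s.support) hs'S
    refine mem_biUnion.2 ⟨s', mem_filter.2 ⟨hS'p hs'S, hvs', hsub⟩,
      mem_image.2 ⟨S'.erase s', ?_, insert_erase hs'S⟩⟩
    refine mem_filter.2 ⟨mem_powerset.2 ((erase_subset _ _).trans hS'p), ?_, ?_⟩
    · rw [card_erase_of_mem hs'S, hS'3]
    · exact tdp_tiling3_erase p hp K hK S' hS'p hS'3 hS'U s' hs'S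
  · intro hS'
    obtain ⟨s', hs'F, hSim⟩ := mem_biUnion.1 hS'
    obtain ⟨hs'p, hvs', hsub⟩ := mem_filter.1 hs'F
    obtain ⟨S'', hS''B, rfl⟩ := mem_image.1 hSim
    obtain ⟨hS''p', hS''2, hS''U⟩ := mem_filter.1 hS''B
    have hS''p : S'' ⊆ p.support := mem_powerset.1 hS''p'
    have hs'S'' : s' ∉ S'' := by
      intro h
      have hv : v ∈ S''.biUnion fun s => s.support := mem_biUnion.2 ⟨s', h, hvs'⟩
      rw [hS''U, mem_sdiff] at hv
      exact hv.2 hvs'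
    refine mem_filter.2 ⟨mem_powerset.2 (insert_subset hs'p hS''p), ?_, ?_⟩
    · rw [card_insert_of_notMem hs'S'', hS''2]
    · rw [biUnion_insert, hS''U, union_sdiff_of_subset hsub]

/-- Counting version: `N₃(K) = Σ_{s' ∋ v, supp s' ⊆ K} N₂(K ∖ supp s')` for a `9`-set `K ∋ v`. [folklore] -/
theorem tdp_tilings3_through (hp : p.totalDegree ≤ 3) (v : Fin (6 + 6)) (K : Finset (Fin (6 + 6))) (hK : #K = 9)
    (hvK : v ∈ K) :
    #{S' ∈ p.support.powerset | #S' = 3 ∧ (S'.biUnion fun s => s.support) = K} =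
      ∑ s' ∈ p.support.filter (fun s' => v ∈ s'.support ∧ s'.support ⊆ K),
        #{S'' ∈ p.support.powerset | #S'' = 2 ∧ (S''.biUnion fun s => s.support) = K \ s'.support} := by
  have key : ∀ s' ∈ p.support.filter (fun s' => v ∈ s'.support ∧ s'.support ⊆ K),
      ∀ S'' ∈ {S'' ∈ p.support.powerset | #S'' = 2 ∧ (S''.biUnion fun s => s.support) = K \ s'.support},
        ∀ s ∈ S'', v ∉ s.support := by
    intro s' hs' S'' hS'' s hs hv
    have hvU : v ∈ S''.biUnion fun s => s.support := mem_biUnion.2 ⟨s, hs, hv⟩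
    rw [(mem_filter.1 hS'').2.2, mem_sdiff] at hvU
    exact hvU.2 (mem_filter.1 hs').2.1
  have hdisj : ((p.support.filter fun s' => v ∈ s'.support ∧ s'.support ⊆ K : Finset _) : Set _).PairwiseDisjoint
      fun s' => ({S'' ∈ p.support.powerset | #S'' = 2 ∧ (S''.biUnion fun s => s.support) = K \ s'.support}).image
        (insert s') := by
    intro s₀ hs₀ s₁ hs₁ hne
    rw [Function.onFun, disjoint_left]
    intro S hS hS1
    obtain ⟨S', hS', rfl⟩ := mem_image.1 hS
    obtain ⟨S'', hS'', hEq⟩ := mem_image.1 hS1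
    have hs₁S : s₁ ∈ insert s₀ S' := by
      rw [← hEq]
      exact mem_insert_self _ _
    rcases mem_insert.1 hs₁S with h | h
    · exact hne h.symm
    · exact key s₀ (mem_coe.1 hs₀) S' hS' s₁ h (mem_filter.1 (mem_coe.1 hs₁)).2.1
  rw [tdp_tilings3_eq_biUnion p hp v K hK hvK, card_biUnion hdisj]
  refine sum_congr rfl fun s₀ hs₀ => card_image_of_injOn fun S' hS' S'' hS'' h => ?_
  have h1 : s₀ ∉ S' := fun hm => key s₀ hs₀ S' (mem_coe.1 hS') s₀ hm (mem_filter.1 hs₀).2.1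
  have h2 : s₀ ∉ S'' := fun hm => key s₀ hs₀ S'' (mem_coe.1 hS'') s₀ hm (mem_filter.1 hs₀).2.1
  rw [← erase_insert h1, h, erase_insert h2]

/-! ### The off-diagonal vanishes mod 2 -/

/-- Two monomials cover at most `6` variables: `N₂(R) = 0` when `|R| > 6`. -/
theorem tdp_tilings2_eq_zero (hp : p.totalDegree ≤ 3) (R : Finset (Fin (6 + 6))) (hR : 6 < #R) :
    #{S'' ∈ p.support.powerset | #S'' = 2 ∧ (S''.biUnion fun s => s.support) = R} = 0 := by
  rw [card_eq_zero, filter_eq_empty_iff]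
  rintro S'' hS'' ⟨h2, hU⟩
  have h6 : #(S''.biUnion fun s => s.support) ≤ 3 * #S'' := ax_card_biUnion_le hp (mem_powerset.1 hS'')
  rw [hU, h2] at h6
  omega

/-- **Off-diagonal of the pairing.**  For `v ≠ w`: `Σ_{s ∈ supp p : v ∈ s, w ∉ s} N₃((insert w (supp s ∖ {v}))ᶜ)` is EVEN.
After `tdp_tilings3_through`, the sum runs over ordered pairs `(s, s')` of monomials through `v` whose supports meet only in `v` and avoid
`w`, with the symmetric summand `N₂` of the complement of `{w} ∪ supp s ∪ supp s'` and vanishing diagonal; the swap involution pairs the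
terms off (`Finset.sum_involution` over `ZMod 2`). [this work] -/
theorem tdp_offdiag_even (hp : p.totalDegree ≤ 3) (v w : Fin (6 + 6)) (hvw : v ≠ w) :
    Even (∑ s ∈ p.support.filter (fun s => v ∈ s.support ∧ w ∉ s.support),
      #{S' ∈ p.support.powerset | #S' = 3 ∧
        (S'.biUnion fun s => s.support) = (insert w (s.support.erase v))ᶜ}) := by
  -- the `9`-sets `K(s)`
  set K : (Fin (6 + 6) →₀ ℕ) → Finset (Fin (6 + 6)) := fun s => (insert w (s.support.erase v))ᶜ with hKdef
  have hvK : ∀ s, v ∈ K s := fun s => by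
    rw [hKdef, mem_compl, mem_insert, mem_erase]; push Not
    exact ⟨hvw, fun h => (h rfl).elim⟩
  have hwK : ∀ s, w ∉ K s := fun s => by
    rw [hKdef, mem_compl, not_not]; exact mem_insert_self _ _
  -- the summand of the double sum, symmetric in `(s, s')`
  set N2 : (Fin (6 + 6) →₀ ℕ) → (Fin (6 + 6) →₀ ℕ) → ℕ := fun s s' =>
    #{S'' ∈ p.support.powerset | #S'' = 2 ∧ (S''.biUnion fun s => s.support) = K s \ s'.support} with hN2def
  -- terms with `|K(s)| ≠ 9` vanish; the others expand through `v`
  have hterm : ∀ s ∈ p.support.filter (fun s => v ∈ s.support ∧ w ∉ s.support),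
      (#{S' ∈ p.support.powerset | #S' = 3 ∧ (S'.biUnion fun s => s.support) = K s} : ZMod 2) =
        ∑ s' ∈ p.support.filter (fun s' => v ∈ s'.support ∧ s'.support ⊆ K s), (N2 s s' : ZMod 2) := by
    intro s hs
    by_cases h9 : #(K s) = 9
    · rw [tdp_tilings3_through p hp v (K s) h9 (hvK s)]
      push_cast
      rfl
    · -- no tiling: both sides vanish (`|K(s)| ≥ 10`)
      obtain ⟨hsp, hvs, -⟩ := mem_filter.1 hs
      have h3 : #s.support ≤ 3 := ax_card_support_le hp hsp
      have hKcard : #(K s) = 12 - #(insert w (s.support.erase v)) := by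
        rw [hKdef, card_compl, Fintype.card_fin]
      have hins : #(insert w (s.support.erase v)) = #s.support := by
        rw [card_insert_of_notMem, card_erase_of_mem hvs]
        · have := card_pos.2 ⟨v, hvs⟩; omega
        · rw [mem_erase]; push Not; intro _ hw; exact absurd hw (mem_filter.1 hs).2.2
      have hKgt : 9 < #(K s) := by rw [hKcard, hins]; omega
      have hL : #{S' ∈ p.support.powerset | #S' = 3 ∧ (S'.biUnion fun s => s.support) = K s} = 0 := by
        rw [card_eq_zero, filter_eq_empty_iff]
        rintro S' hS' ⟨h3', hU⟩
        have h9' : #(S'.biUnion fun s => s.support) ≤ 3 * #S' := ax_card_biUnion_le hp (mem_powerset.1 hS')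
        rw [hU, h3'] at h9'
        omega
      have hR : ∀ s' ∈ p.support.filter (fun s' => v ∈ s'.support ∧ s'.support ⊆ K s), (N2 s s' : ZMod 2) = 0 := by
        intro s' hs'
        have h3' : #s'.support ≤ 3 := ax_card_support_le hp (mem_filter.1 hs').1
        have hsd : 6 < #(K s \ s'.support) := by
          have := card_sdiff_add_card_inter (K s) s'.support
          have hint : #(K s ∩ s'.support) ≤ 3 := (card_le_card inter_subset_right).trans h3'
          omega
        rw [hN2def]
        simp only
        rw [tdp_tilings2_eq_zero p hp _ hsd, Nat.cast_zero]
      rw [hL, Nat.cast_zero, sum_congr rfl hR, sum_const_zero]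
  -- pass to `ZMod 2`
  rw [← ZMod.natCast_eq_zero_iff_even, Nat.cast_sum, sum_congr rfl hterm]
  -- the index set of the double sum as a set of ordered pairs
  set D : Finset ((Fin (6 + 6) →₀ ℕ) × (Fin (6 + 6) →₀ ℕ)) :=
    (p.support ×ˢ p.support).filter fun q => (v ∈ q.1.support ∧ w ∉ q.1.support) ∧
      (v ∈ q.2.support ∧ q.2.support ⊆ K q.1) with hDdef
  have hdouble : ∑ s ∈ p.support.filter (fun s => v ∈ s.support ∧ w ∉ s.support),
      ∑ s' ∈ p.support.filter (fun s' => v ∈ s'.support ∧ s'.support ⊆ K s), (N2 s s' : ZMod 2) =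
        ∑ q ∈ D, (N2 q.1 q.2 : ZMod 2) := by
    rw [hDdef]
    conv_rhs => rw [sum_filter, sum_product]
    conv_lhs => rw [sum_filter]
    refine sum_congr rfl fun s _ => ?_
    by_cases hs : v ∈ s.support ∧ w ∉ s.support
    · rw [if_pos hs, sum_filter]
      refine sum_congr rfl fun s' _ => ?_
      by_cases hc : v ∈ s'.support ∧ s'.support ⊆ K s
      · rw [if_pos hc, if_pos ⟨hs, hc⟩]
      · rw [if_neg hc, if_neg (fun h => hc h.2)]
    · rw [if_neg hs]
      symm
      refine sum_eq_zero fun s' _ => ?_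
      rw [if_neg (fun h => hs h.1)]
  rw [hdouble]
  -- membership in `D` is symmetric, the summand is symmetric, the diagonal vanishes
  have hmemD : ∀ q : (Fin (6 + 6) →₀ ℕ) × (Fin (6 + 6) →₀ ℕ), q ∈ D ↔
      (q.1 ∈ p.support ∧ q.2 ∈ p.support) ∧ (v ∈ q.1.support ∧ w ∉ q.1.support) ∧
        (v ∈ q.2.support ∧ q.2.support ⊆ K q.1) := fun q => by
    rw [hDdef, mem_filter, mem_product]
  have hKsub : ∀ s s' : Fin (6 + 6) →₀ ℕ, s'.support ⊆ K s ↔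
      (w ∉ s'.support ∧ ∀ i ∈ s'.support, i ∈ s.support → i = v) := by
    intro s s'
    rw [hKdef]
    simp only [subset_iff, mem_compl, mem_insert, mem_erase, not_or, not_and]
    constructor
    · intro h
      refine ⟨fun hw => (h hw).1 rfl, fun i hi his => ?_⟩
      by_contra hne
      exact (h hi).2 hne his
    · rintro ⟨hw, h⟩ i hi
      exact ⟨fun hiw => hw (hiw ▸ hi), fun hne his => hne (h i hi his)⟩
  have hswap : ∀ q ∈ D, q.swap ∈ D := by
    intro q hq
    obtain ⟨⟨h1, h2⟩, ⟨hv1, hw1⟩, ⟨hv2, hsub⟩⟩ := (hmemD q).1 hq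
    obtain ⟨hw2, hmeet⟩ := (hKsub q.1 q.2).1 hsub
    refine (hmemD q.swap).2 ⟨⟨h2, h1⟩, ⟨hv2, hw2⟩, ⟨hv1, (hKsub q.2 q.1).2 ⟨hw1, fun i hi his => hmeet i his hi⟩⟩⟩
  have hsymm : ∀ q ∈ D, K q.1 \ q.2.support = K q.2 \ q.1.support := by
    intro q hq
    obtain ⟨-, ⟨hv1, hw1⟩, ⟨hv2, hsub⟩⟩ := (hmemD q).1 hq
    obtain ⟨hw2, hmeet⟩ := (hKsub q.1 q.2).1 hsub
    ext i
    rw [hKdef]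
    simp only [mem_sdiff, mem_compl, mem_insert, mem_erase, not_or, not_and]
    constructor
    · rintro ⟨⟨hiw, h1⟩, h2⟩
      refine ⟨⟨hiw, fun hne hi2 => h2 hi2⟩, fun hi1 => ?_⟩
      have hiv : i = v := by
        by_contra hne; exact (h1 hne) hi1
      exact h2 (hiv ▸ hv2)
    · rintro ⟨⟨hiw, h2⟩, h1⟩
      refine ⟨⟨hiw, fun hne hi1 => h1 hi1⟩, fun hi2 => ?_⟩
      have hiv : i = v := by
        by_contra hne; exact (h2 hne) hi2
      exact h1 (hiv ▸ hv1)
  have hdiag : ∀ q ∈ D, q.swap = q → (N2 q.1 q.2 : ZMod 2) = 0 := by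
    intro q hq hqq
    obtain ⟨⟨h1, -⟩, ⟨hv1, hw1⟩, ⟨-, hsub⟩⟩ := (hmemD q).1 hq
    have heq : q.2 = q.1 := by
      have := congrArg Prod.fst hqq
      simpa using this
    rw [heq] at hsub
    obtain ⟨-, hmeet⟩ := (hKsub q.1 q.1).1 hsub
    -- `supp q.1 = {v}`, so `K q.1 ∖ supp q.1` has `10` elements
    have hsupp : q.1.support ⊆ {v} := fun i hi => mem_singleton.2 (hmeet i hi hi)
    have hcard1 : #q.1.support = 1 := by
      have := card_le_card hsupp
      rw [card_singleton] at this
      have hpos := card_pos.2 ⟨v, hv1⟩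
      omega
    have hKc : #(K q.1) = 11 := by
      rw [hKdef]
      simp only
      rw [card_compl, Fintype.card_fin, card_insert_of_notMem, card_erase_of_mem hv1, hcard1]
      rw [mem_erase]; push Not; intro _ hw; exact absurd hw hw1
    have hsd : 6 < #(K q.1 \ q.2.support) := by
      rw [heq]
      have := card_sdiff_add_card_inter (K q.1) q.1.support
      have hint : #(K q.1 ∩ q.1.support) ≤ 1 := (card_le_card inter_subset_right).trans hcard1.le
      omega
    rw [hN2def]
    simp only
    rw [tdp_tilings2_eq_zero p hp _ hsd, Nat.cast_zero]
  refine Finset.sum_involution (fun q _ => q.swap) (fun q hq => ?_) (fun q hq hne => ?_) (fun q hq => hswap q hq)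
    (fun q _ => Prod.swap_swap q)
  · -- `f q + f q.swap = 0` in `ZMod 2`
    have hs : N2 q.swap.1 q.swap.2 = N2 q.1 q.2 := by
      rw [hN2def]
      simp only [Prod.fst_swap, Prod.snd_swap]
      rw [← hsymm q hq]
    rw [hs]
    generalize (N2 q.1 q.2 : ZMod 2) = a
    have : a + a = 2 * a := by ring
    rw [this]
    have h2 : (2 : ZMod 2) = 0 := by decide
    rw [h2, zero_mul]
  · intro hfix
    exact hne (hdiag q hq hfix)

end Pairing

end Summit.QuantumAdvantage.QuantumAdvantage.Theorems.CubicForrelation.NearExactIsExact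

end
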